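import Summits.QuantumAdvantage.QuantumAdvantage.Theorems.LinnikCubicClassGroupsDegreeOnePrimesEscapeLowerShadowAdd
import HarnessLib

/-!
# Crux `DegreeOnePrimesEscape` (stmt-QuantumAdvantage-11543) — the lower shadow from the DEGREE-LOCAL additive class PNT

Line `dedekind-s3-collision`.  The registered stub `stub_lowerShadowAdd` (`…LowerShadowAdd.lean`) consumes the
additive class PNT dichotomy with ONE constant `c₁` for ALL degrees; the tree proves the DEGREE-LOCAL form
unconditionally (`classPNTAdditive_allFields`, p179022).  This file re-proves the lower shadow
(`29·Li(x) ≤ 32·π_K(x)` for `x ≥ Q^{C₁(n)}`, every `K` of degree `n > 1` without quadratic subfield) from the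
degree-local additive hypothesis `∀ n > 1, ∃ c₁(n), …` and Stark's inexplicit non-vanishing — the same
field-by-field argument as the registered stub (sum over all classes; the `β₁`-terms cancel unless `χ₁ = 1`;
if `χ₁ = 1`, Stark gives `(1 − β₁) log x ≥ 4`), with the quantifiers `∀ n` / `∃ c₁` exchanged.  Cell B2b-1
(linnik-cubic), PART B; value = theorem, NOT summit progress.
-/

noncomputable section

open scoped NumberField nonZeroDivisors
open Literature.NumberTheory.LFunctions Literature.NumberTheory.LFunctions.NumberField

namespace Summit.QuantumAdvantage.QuantumAdvantage.Theorems.DegreeOnePrimesEscape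

/-- **The lower shadow from the DEGREE-LOCAL additive class PNT dichotomy and Stark's inexplicit
no-quadratic-subfield non-vanishing** (line `dedekind-s3-collision`). -/
theorem lowerShadow_of_additive_local :
    (∀ n : ℕ, 1 < n → ∃ c₁ : ℝ, 0 < c₁ ∧ ∀ (K : Type) [Field K] [NumberField K], Module.finrank ℚ K = n →
      ((∀ (C : ClassGroup (𝓞 K)) (x : ℝ), ThornerZaman.condQn K ^ c₁ ≤ x →
          |(primeIdealClassCount K C x : ℝ) - offsetLogIntegral x / NumberField.classNumber K| ≤
            offsetLogIntegral x / (32 * NumberField.classNumber K)) ∨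
        ∃ (χ₁ : ClassGroup (𝓞 K) →* ℂˣ) (β₁ : ℝ), χ₁ * χ₁ = 1 ∧
          1 - 1 / (8 * Real.log (ThornerZaman.condQn K)) < β₁ ∧ β₁ < 1 ∧
          classGroupLFunction K χ₁ β₁ = 0 ∧
          ∀ (C : ClassGroup (𝓞 K)) (x : ℝ), ThornerZaman.condQn K ^ c₁ ≤ x →
            |(primeIdealClassCount K C x : ℝ) -
                (offsetLogIntegral x - ((χ₁ C : ℂ)).re * offsetLogIntegral (x ^ β₁)) /
                  NumberField.classNumber K| ≤
              offsetLogIntegral x / (32 * NumberField.classNumber K))) →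
    (∀ n : ℕ, ∃ c : ℝ, 0 < c ∧ ∀ (K : Type) [Field K] [NumberField K], Module.finrank ℚ K = n →
      (∀ F : IntermediateField ℚ K, Module.finrank ℚ F ≠ 2) →
      ∀ σ : ℝ, 1 - c / Real.log ((NumberField.discr K).natAbs : ℝ) ≤ σ → σ < 1 →
        dedekindZetaCont K σ ≠ 0) →
    ∀ n : ℕ, 1 < n → ∃ C₁ : ℝ, ∀ (K : Type) [Field K] [NumberField K], Module.finrank ℚ K = n →
      (∀ F : IntermediateField ℚ K, Module.finrank ℚ F ≠ 2) →
      ∀ x : ℝ, ThornerZaman.condQn K ^ C₁ ≤ x →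
        29 * offsetLogIntegral x ≤ 32 * (primeIdealCount K x : ℝ) := by
  intro hAdd hSt
  classical
  intro n hn
  obtain ⟨c₁, hc₁, H⟩ := hAdd n hn
  obtain ⟨c, hc, hS⟩ := hSt n
  refine ⟨max (max c₁ 44) (4 / c), ?_⟩
  intro K _ _ hKn hnq x hx
  have hK : 1 < Module.finrank ℚ K := by rw [hKn]; exact hn
  set C₁ : ℝ := max (max c₁ 44) (4 / c) with hC₁def
  set Q : ℝ := ThornerZaman.condQn K with hQdef
  set h : ℕ := NumberField.classNumber K with hhdef
  -- basic sizes
  have hQ12 : 12 ≤ Q := ThornerZaman.twelve_le_condQn (K := K) hK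
  have hQ1 : 1 ≤ Q := by linarith
  have hQpos : 0 < Q := by linarith
  have hC₁c₁ : c₁ ≤ C₁ := le_trans (le_max_left _ _) (le_max_left _ _)
  have hC₁44 : 44 ≤ C₁ := le_trans (le_max_right _ _) (le_max_left _ _)
  have hC₁c : 4 / c ≤ C₁ := le_max_right _ _
  have hC₁0 : 0 ≤ C₁ := by linarith
  have hxc₁ : Q ^ c₁ ≤ x := le_trans (Real.rpow_le_rpow_of_exponent_le hQ1 hC₁c₁) hx
  have hxpos : 0 < x := lt_of_lt_of_le (Real.rpow_pos_of_pos hQpos _) hx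
  have hlogx : C₁ * Real.log Q ≤ Real.log x := by
    have := Real.log_le_log (Real.rpow_pos_of_pos hQpos _) hx
    rwa [Real.log_rpow hQpos] at this
  have hlog2 : (0.6931471803 : ℝ) < Real.log 2 := Real.log_two_gt_d9
  have hlogQ2 : 2 * Real.log 2 ≤ Real.log Q := by
    have h1 := Dock.finrank_mul_log_two_le_log_condQn K hK
    have h2 : (2 : ℝ) ≤ Module.finrank ℚ K := by exact_mod_cast hK
    nlinarith
  have hlogQpos : 0 < Real.log Q := by linarith
  have hlogx60 : 60 ≤ Real.log x := by nlinarith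
  have hx_exp : Real.exp 60 ≤ x := (Real.le_log_iff_exp_le hxpos).1 hlogx60
  have hx1 : 1 < x := by
    have : (1:ℝ) < Real.exp 60 := by have := Real.add_one_le_exp (60:ℝ); linarith
    linarith
  have hlogxpos : 0 < Real.log x := by linarith
  have hLiup : offsetLogIntegral x ≤ 26 / 25 * (x / Real.log x) :=
    Dock.offsetLogIntegral_le_mul_div_log hx_exp
  have hxl : 0 ≤ x / Real.log x := by positivity
  -- per-class lower bound from the additive error
  have key : ∀ (π m : ℝ), |π - m| ≤ offsetLogIntegral x / (32 * h) →
      m - offsetLogIntegral x / (32 * h) ≤ π := by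
    intro π m hπ
    have h1 := (abs_sub_le_iff.1 hπ).2
    linarith
  -- total count
  have htot : (primeIdealCount K x : ℝ) = ∑ C : ClassGroup (𝓞 K), (primeIdealClassCount K C x : ℝ) := by
    exact_mod_cast Dock.primeIdealCount_eq_sum_classCount K x
  have hcardC : ((Finset.univ : Finset (ClassGroup (𝓞 K))).card : ℝ) = h := by
    rw [Finset.card_univ, hhdef, NumberField.classNumber]
  have hhpos : (0 : ℝ) < h := by exact_mod_cast NumberField.classNumber_pos (K := K)
  rcases H K hKn with hA | ⟨χ₁, β₁, -, hβlo, hβhi, hzero, hB⟩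
  · -- no exceptional zero: π_K ≥ (31/32) Li
    have hC : ∀ C : ClassGroup (𝓞 K),
        offsetLogIntegral x / h - offsetLogIntegral x / (32 * h) ≤ (primeIdealClassCount K C x : ℝ) :=
      fun C => key _ _ (hA C x hxc₁)
    have hπ : 31 / 32 * offsetLogIntegral x ≤ (primeIdealCount K x : ℝ) := by
      rw [htot]
      calc 31 / 32 * offsetLogIntegral x
          = ∑ C : ClassGroup (𝓞 K), (offsetLogIntegral x / h - offsetLogIntegral x / (32 * h)) := by
            rw [Finset.sum_const, nsmul_eq_mul, hcardC]; field_simp; ring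
        _ ≤ ∑ C : ClassGroup (𝓞 K), (primeIdealClassCount K C x : ℝ) :=
            Finset.sum_le_sum fun C _ => hC C
    have hLix : 0 ≤ offsetLogIntegral x := by
      have h2 : (2:ℝ) ≤ x := by have := Real.add_one_le_exp (60:ℝ); linarith
      have := sub_mul_inv_log_pow_le_offsetLogIntegralPow 1 h2
      rw [offsetLogIntegralPow_one] at this
      have h0 : 0 ≤ (x - 2) * (Real.log x)⁻¹ ^ 1 := by
        apply mul_nonneg (by linarith); positivity
      linarith
    linarith only [hπ, hLix]
  · -- exceptional (χ₁, β₁)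
    have hC : ∀ C : ClassGroup (𝓞 K),
        (offsetLogIntegral x - ((χ₁ C : ℂ)).re * offsetLogIntegral (x ^ β₁)) / h
            - offsetLogIntegral x / (32 * h)
          ≤ (primeIdealClassCount K C x : ℝ) :=
      fun C => key _ _ (hB C x hxc₁)
    have hsumπ : (∑ C : ClassGroup (𝓞 K),
        (offsetLogIntegral x - ((χ₁ C : ℂ)).re * offsetLogIntegral (x ^ β₁)) / h)
          - offsetLogIntegral x / 32 ≤ (primeIdealCount K x : ℝ) := by
      rw [htot]
      have hs := Finset.sum_le_sum fun C (_ : C ∈ (Finset.univ : Finset (ClassGroup (𝓞 K)))) => hC C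
      rw [Finset.sum_sub_distrib, Finset.sum_const, nsmul_eq_mul, hcardC] at hs
      have e : (h : ℝ) * (offsetLogIntegral x / (32 * h)) = offsetLogIntegral x / 32 := by
        field_simp
      linarith [hs, e]
    have hsum : ∑ C : ClassGroup (𝓞 K),
        (offsetLogIntegral x - ((χ₁ C : ℂ)).re * offsetLogIntegral (x ^ β₁)) / (h : ℝ)
        = ((h : ℝ) * offsetLogIntegral x
            - (∑ C : ClassGroup (𝓞 K), ((χ₁ C : ℂ)).re) * offsetLogIntegral (x ^ β₁)) / h := by
      rw [← Finset.sum_div, Finset.sum_sub_distrib, Finset.sum_const, nsmul_eq_mul, Finset.sum_mul,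
        hcardC]
    -- Li(x) ≥ 0 and the two subcases
    have hx2 : (2:ℝ) ≤ x := by have := Real.add_one_le_exp (60:ℝ); linarith
    have hLix : 0 ≤ offsetLogIntegral x := by
      have := sub_mul_inv_log_pow_le_offsetLogIntegralPow 1 hx2
      rw [offsetLogIntegralPow_one] at this
      have h0 : 0 ≤ (x - 2) * (Real.log x)⁻¹ ^ 1 := by
        apply mul_nonneg (by linarith); positivity
      linarith
    by_cases hχ1 : χ₁ = 1
    · -- χ₁ trivial: β₁ is a zero of ζ_K; Stark pushes it left
      subst hχ1
      have hre : ∑ C : ClassGroup (𝓞 K), (((1 : ClassGroup (𝓞 K) →* ℂˣ) C : ℂ)).re = h := by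
        simp only [MonoidHom.one_apply, Units.val_one, Complex.one_re, Finset.sum_const,
          nsmul_eq_mul, mul_one]
        exact hcardC
      rw [hre] at hsum
      have hmain : ∑ C : ClassGroup (𝓞 K),
          (offsetLogIntegral x - (((1 : ClassGroup (𝓞 K) →* ℂˣ) C : ℂ)).re * offsetLogIntegral (x ^ β₁)) / (h : ℝ)
          = offsetLogIntegral x - offsetLogIntegral (x ^ β₁) := by
        rw [hsum]; field_simp
      rw [hmain] at hsumπ
      -- Stark
      have hβ1c : (β₁ : ℂ) ≠ 1 := by
        intro heq
        have := congrArg Complex.re heq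
        simp at this
        linarith
      have hzeta : dedekindZetaCont K β₁ = 0 := by
        rw [← classGroupLFunction_one K hβ1c]; exact hzero
      set d : ℝ := ((NumberField.discr K).natAbs : ℝ) with hddef
      have hd_eq : d = |(NumberField.discr K : ℝ)| := by
        rw [hddef, Nat.cast_natAbs, Int.cast_abs]
      have hd3 : (3 : ℝ) ≤ d := by
        have h2 := NumberField.abs_discr_gt_two hK
        rw [hd_eq, ← Int.cast_abs]
        exact_mod_cast (show (3:ℤ) ≤ |NumberField.discr K| by omega)
      have hdpos : 0 < d := by linarith
      have hlogd : 0 < Real.log d := Real.log_pos (by linarith)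
      have hdQ : d ≤ Q := by
        rw [hQdef, ThornerZaman.condQn, hd_eq]
        have hn1 : (1:ℝ) ≤ (Module.finrank ℚ K : ℝ) ^ Module.finrank ℚ K :=
          one_le_pow₀ (by exact_mod_cast hK.le)
        have h0 : 0 ≤ |(NumberField.discr K : ℝ)| := abs_nonneg _
        nlinarith
      have hlogdQ : Real.log d ≤ Real.log Q := Real.log_le_log hdpos hdQ
      have hβup : β₁ < 1 - c / Real.log d := by
        by_contra hcon
        rw [not_lt] at hcon
        exact hS K hKn hnq β₁ hcon hβhi hzeta
      -- (1 − β₁) log x ≥ 4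
      have hgap : 4 ≤ (1 - β₁) * Real.log x := by
        have h1 : c / Real.log d ≤ 1 - β₁ := by linarith only [hβup]
        have hcd : 0 ≤ c / Real.log d := div_nonneg hc.le hlogd.le
        have h2 : c / Real.log d * (C₁ * Real.log d) = c * C₁ := by
          field_simp
        have h3 : c / Real.log d * (C₁ * Real.log d) ≤ c / Real.log d * Real.log x := by
          apply mul_le_mul_of_nonneg_left _ hcd
          have : C₁ * Real.log d ≤ C₁ * Real.log Q := mul_le_mul_of_nonneg_left hlogdQ hC₁0
          linarith only [this, hlogx]
        have h4 : 4 ≤ c * C₁ := by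
          have := (div_le_iff₀ hc).1 hC₁c; linarith only [this]
        have h5 : c / Real.log d * Real.log x ≤ (1 - β₁) * Real.log x :=
          mul_le_mul_of_nonneg_right h1 hlogxpos.le
        linarith only [h2, h3, h4, h5]
      -- x^{β₁} ≤ x / 50
      have hβpos : 0 < β₁ := by
        have hlQ1 : 1 ≤ Real.log Q := by linarith only [hlogQ2, hlog2]
        have : 1 / (8 * Real.log Q) ≤ 1 / 8 :=
          one_div_le_one_div_of_le (by norm_num) (by linarith only [hlQ1])
        linarith only [this, hβlo]
      have hxβ : x ^ β₁ ≤ x / 50 := by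
        have h1 : x ^ β₁ = x ^ (β₁ - 1) * x := by
          rw [← Real.rpow_add_one hxpos.ne' (β₁ - 1)]; norm_num
        have h2 : x ^ (β₁ - 1) ≤ Real.exp (-4) := by
          rw [Real.rpow_def_of_pos hxpos]
          apply Real.exp_le_exp.2
          nlinarith only [hgap]
        have h3 : Real.exp (-4) ≤ 1 / 50 := by
          rw [Real.exp_neg]
          have h50 : (50:ℝ) ≤ Real.exp 4 := by
            have e1 : Real.exp 4 = Real.exp 1 ^ 4 := by rw [← Real.exp_nat_mul]; norm_num
            have e2 : (2.7 : ℝ) ≤ Real.exp 1 := le_of_lt (lt_trans (by norm_num) Real.exp_one_gt_d9)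
            rw [e1]
            calc (50:ℝ) ≤ 2.7 ^ 4 := by norm_num
              _ ≤ Real.exp 1 ^ 4 := pow_le_pow_left₀ (by norm_num) e2 4
          rw [inv_eq_one_div, div_le_div_iff₀ (Real.exp_pos 4) (by norm_num)]
          linarith
        rw [h1]
        have : x ^ (β₁ - 1) * x ≤ (1 / 50) * x := by
          apply mul_le_mul_of_nonneg_right (le_trans h2 h3) hxpos.le
        linarith only [this]
      -- Li x − Li x^β ≥ (x − x^β)/log x ≥ (49/50) x / log x
      have hdiff : (x - x ^ β₁) / Real.log x ≤ offsetLogIntegral x - offsetLogIntegral (x ^ β₁) :=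
        sub_rpow_div_log_le_offsetLogIntegral_sub hx1 hβpos hβhi.le
      have hdiff2 : 49 / 50 * (x / Real.log x) ≤ (x - x ^ β₁) / Real.log x := by
        rw [mul_div_assoc', div_le_div_iff_of_pos_right hlogxpos]
        linarith only [hxβ]
      -- assemble: 8 π_K ≥ 8 (31/32)(49/50)(x/log x) ≥ 7 (26/25)(x / log x) ≥ 7 Li
      linarith only [hsumπ, hdiff, hdiff2, hLiup, hxl]
    · -- χ₁ nontrivial: the β₁-terms cancel
      have hψ : (Units.coeHom ℂ).comp χ₁ ≠ 1 := by
        intro heq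
        apply hχ1
        ext C
        have := DFunLike.congr_fun heq C
        simpa using this
      have hre : ∑ C : ClassGroup (𝓞 K), ((χ₁ C : ℂ)).re = 0 := by
        have h0 := sum_hom_units_eq_zero ((Units.coeHom ℂ).comp χ₁) hψ
        rw [← Complex.re_sum]
        have : ∑ C : ClassGroup (𝓞 K), (χ₁ C : ℂ) = ∑ C : ClassGroup (𝓞 K), ((Units.coeHom ℂ).comp χ₁) C := by
          apply Finset.sum_congr rfl; intro C _; rfl
        rw [this, h0, Complex.zero_re]
      rw [hre] at hsum
      have hmain : ∑ C : ClassGroup (𝓞 K),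
          (offsetLogIntegral x - ((χ₁ C : ℂ)).re * offsetLogIntegral (x ^ β₁)) / (h : ℝ)
          = offsetLogIntegral x := by
        rw [hsum, zero_mul, sub_zero, mul_div_assoc, mul_div_cancel₀ _ hhpos.ne']
      rw [hmain] at hsumπ
      linarith only [hsumπ, hLix]

end Summit.QuantumAdvantage.QuantumAdvantage.Theorems.DegreeOnePrimesEscape

end
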